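import Summits.AnomalousDissipation.AnomalousDissipation.Theorems.MomentParityCubicParityLoudDiagonalClassificationTriad

/-!
# Rigidity of the effective Casimir blocks on the unit box of frequencies

Helper file for stub `stub_diagonalClassification` (S3b) of the line `farkas-split-menu` of crux
`MomentParity.CubicParityLoud`.  The UNIT BOX is the set of seven frequencies
`U = {e₁, e₂, e₃, e₁+e₂, e₁+e₃, e₂+e₃, e₁+e₂+e₃}`; its six internal triads are the three
right-angled face triads `(eᵢ, eⱼ, eᵢ+eⱼ)` and the three body triads `(eᵢ, eⱼ+eₖ, e₁+e₂+e₃)`.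
If symmetric compressed blocks `M k` (`(M k)ᵀ = M k`, `M k k = 0`), resp. scalars `λ k`, on `U`
satisfy the symmetric, resp. antisymmetric, single-triad identities of
`…DiagonalClassificationTriad` on these six triads, then `M k = α·id` on `k^⊥`, resp.
`λ k = β`, for all seven `k ∈ U` and suitable constants `α`, `β` (a single planar triad is NOT
rigid for the symmetric blocks — it carries the invariants of 2.5-dimensional flow — but the
non-coplanar box is).  The proofs are finite linear algebra: instances of the identities at the
adapted test vectors `n = a × b`, `k × n`, expanded into matrix entries, followed by explicit
rational eliminations (certificates found by exact Gaussian elimination offline and checked here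
by `linear_combination`).
-/

namespace Summit.AnomalousDissipation.AnomalousDissipation.Theorems.MomentParityCubicParityLoud

open Matrix

set_option linter.dupNamespace false

/-- Real cast of an explicit integer frequency `![x, y, z]`. [folklore] -/
theorem cast_vec3 (x y z : ℤ) : (fun i => ((![x, y, z] : Fin 3 → ℤ) i : ℝ)) = ![(x : ℝ), y, z] := by
  ext i; fin_cases i <;> simp

set_option maxHeartbeats 2000000 in
/-- **Rigidity of the symmetric blocks on the unit box.**  Symmetric compressed blocks on the
unit box `U` satisfying the symmetric triad identity on its six internal triads are `α · id` on
`k^⊥` for all `k ∈ U`. [folklore] -/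
theorem unitBox_S (M : (Fin 3 → ℤ) → Matrix (Fin 3) (Fin 3) ℝ)
    (hsymm : ∀ k ∈ ({![1, 0, 0], ![0, 1, 0], ![0, 0, 1], ![1, 1, 0], ![1, 0, 1], ![0, 1, 1], ![1, 1, 1]} : Finset (Fin 3 → ℤ)), (M k).IsSymm)
    (hker : ∀ k ∈ ({![1, 0, 0], ![0, 1, 0], ![0, 0, 1], ![1, 1, 0], ![1, 0, 1], ![0, 1, 1], ![1, 1, 1]} : Finset (Fin 3 → ℤ)), M k *ᵥ (fun i => (k i : ℝ)) = 0)
    (hS : ∀ a ∈ ({![1, 0, 0], ![0, 1, 0], ![0, 0, 1], ![1, 1, 0], ![1, 0, 1], ![0, 1, 1], ![1, 1, 1]} : Finset (Fin 3 → ℤ)), ∀ b ∈ ({![1, 0, 0], ![0, 1, 0], ![0, 0, 1], ![1, 1, 0], ![1, 0, 1], ![0, 1, 1], ![1, 1, 1]} : Finset (Fin 3 → ℤ)), ∀ c ∈ ({![1, 0, 0], ![0, 1, 0], ![0, 0, 1], ![1, 1, 0], ![1, 0, 1], ![0, 1, 1], ![1, 1, 1]} : Finset (Fin 3 → ℤ)),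 a + b = c → crossProduct a b ≠ 0 →
      ∀ ua ub uc : Fin 3 → ℝ, ua ⬝ᵥ (fun i => (a i : ℝ)) = 0 → ub ⬝ᵥ (fun i => (b i : ℝ)) = 0 →
        uc ⬝ᵥ (fun i => (c i : ℝ)) = 0 →
        ((uc ⬝ᵥ fun i => (b i : ℝ)) • ub - (ub ⬝ᵥ fun i => (a i : ℝ)) • uc) ⬝ᵥ (M a *ᵥ ua) +
        ((uc ⬝ᵥ fun i => (a i : ℝ)) • ua - (ua ⬝ᵥ fun i => (b i : ℝ)) • uc) ⬝ᵥ (M b *ᵥ ub) +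
        ((ua ⬝ᵥ fun i => (b i : ℝ)) • ub + (ub ⬝ᵥ fun i => (a i : ℝ)) • ua) ⬝ᵥ (M c *ᵥ uc) = 0) :
    ∃ α : ℝ, ∀ k ∈ ({![1, 0, 0], ![0, 1, 0], ![0, 0, 1], ![1, 1, 0], ![1, 0, 1], ![0, 1, 1], ![1, 1, 1]} : Finset (Fin 3 → ℤ)),
      ∀ u w : Fin 3 → ℝ, w ⬝ᵥ (fun i => (k i : ℝ)) = 0 → u ⬝ᵥ (M k *ᵥ w) = α * (u ⬝ᵥ w) := by
  have sp : (M ![1, 0, 0]).IsSymm := hsymm _ (by decide); have sp01 := sp.apply 0 1; have sp02 := sp.apply 0 2; have sp12 := sp.apply 1 2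
  have sq : (M ![0, 1, 0]).IsSymm := hsymm _ (by decide); have sq01 := sq.apply 0 1; have sq02 := sq.apply 0 2; have sq12 := sq.apply 1 2
  have sr : (M ![0, 0, 1]).IsSymm := hsymm _ (by decide); have sr01 := sr.apply 0 1; have sr02 := sr.apply 0 2; have sr12 := sr.apply 1 2
  have sf : (M ![1, 1, 0]).IsSymm := hsymm _ (by decide); have sf01 := sf.apply 0 1; have sf02 := sf.apply 0 2; have sf12 := sf.apply 1 2
  have sg : (M ![1, 0, 1]).IsSymm := hsymm _ (by decide); have sg01 := sg.apply 0 1; have sg02 := sg.apply 0 2; have sg12 := sg.apply 1 2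
  have sh : (M ![0, 1, 1]).IsSymm := hsymm _ (by decide); have sh01 := sh.apply 0 1; have sh02 := sh.apply 0 2; have sh12 := sh.apply 1 2
  have sd : (M ![1, 1, 1]).IsSymm := hsymm _ (by decide); have sd01 := sd.apply 0 1; have sd02 := sd.apply 0 2; have sd12 := sd.apply 1 2
  have kp := hker ![1, 0, 0] (by decide)
  have cp2 := congrFun kp 2
  simp only [Pi.zero_apply, Matrix.mulVec, dotProduct, Fin.sum_univ_three, cons_val_zero, cons_val_one, cons_val_two, head_cons, tail_cons, Int.cast_zero, Int.cast_one, sp02, sp12] at cp2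
  have kq := hker ![0, 1, 0] (by decide)
  have cq2 := congrFun kq 2
  simp only [Pi.zero_apply, Matrix.mulVec, dotProduct, Fin.sum_univ_three, cons_val_zero, cons_val_one, cons_val_two, head_cons, tail_cons, Int.cast_zero, Int.cast_one, sq02, sq12] at cq2
  have kr := hker ![0, 0, 1] (by decide)
  have cr0 := congrFun kr 0
  simp only [Pi.zero_apply, Matrix.mulVec, dotProduct, Fin.sum_univ_three, cons_val_zero, cons_val_one, cons_val_two, head_cons, tail_cons, Int.cast_zero, Int.cast_one] at cr0
  have cr1 := congrFun kr 1
  simp only [Pi.zero_apply, Matrix.mulVec, dotProduct, Fin.sum_univ_three, cons_val_zero, cons_val_one, cons_val_two, head_cons, tail_cons, Int.cast_zero, Int.cast_one, sr01] at cr1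
  have kf := hker ![1, 1, 0] (by decide)
  have cf2 := congrFun kf 2
  simp only [Pi.zero_apply, Matrix.mulVec, dotProduct, Fin.sum_univ_three, cons_val_zero, cons_val_one, cons_val_two, head_cons, tail_cons, Int.cast_zero, Int.cast_one, sf02, sf12] at cf2
  have kg := hker ![1, 0, 1] (by decide)
  have cg0 := congrFun kg 0
  simp only [Pi.zero_apply, Matrix.mulVec, dotProduct, Fin.sum_univ_three, cons_val_zero, cons_val_one, cons_val_two, head_cons, tail_cons, Int.cast_zero, Int.cast_one] at cg0
  have cg1 := congrFun kg 1
  simp only [Pi.zero_apply, Matrix.mulVec, dotProduct, Fin.sum_univ_three, cons_val_zero, cons_val_one, cons_val_two, head_cons, tail_cons, Int.cast_zero, Int.cast_one, sg01] at cg1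
  have cg2 := congrFun kg 2
  simp only [Pi.zero_apply, Matrix.mulVec, dotProduct, Fin.sum_univ_three, cons_val_zero, cons_val_one, cons_val_two, head_cons, tail_cons, Int.cast_zero, Int.cast_one, sg02, sg12] at cg2
  have kh := hker ![0, 1, 1] (by decide)
  have ch0 := congrFun kh 0
  simp only [Pi.zero_apply, Matrix.mulVec, dotProduct, Fin.sum_univ_three, cons_val_zero, cons_val_one, cons_val_two, head_cons, tail_cons, Int.cast_zero, Int.cast_one] at ch0
  have ch1 := congrFun kh 1
  simp only [Pi.zero_apply, Matrix.mulVec, dotProduct, Fin.sum_univ_three, cons_val_zero, cons_val_one, cons_val_two, head_cons, tail_cons, Int.cast_zero, Int.cast_one, sh01] at ch1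
  have ch2 := congrFun kh 2
  simp only [Pi.zero_apply, Matrix.mulVec, dotProduct, Fin.sum_univ_three, cons_val_zero, cons_val_one, cons_val_two, head_cons, tail_cons, Int.cast_zero, Int.cast_one, sh02, sh12] at ch2
  have kd := hker ![1, 1, 1] (by decide)
  have t1 := hS ![1, 0, 0] (by decide) ![0, 1, 0] (by decide) ![1, 1, 0] (by decide) (by decide) (by decide) ![0, 0, 1] ![1, 0, 0] ![0, 0, 1]
    (by norm_num [cast_vec3, vec3_dotProduct]) (by norm_num [cast_vec3, vec3_dotProduct]) (by norm_num [cast_vec3, vec3_dotProduct])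
  simp only [Matrix.mulVec, dotProduct, Fin.sum_univ_three, cons_val_zero, cons_val_one, cons_val_two, head_cons, tail_cons, Pi.add_apply, Pi.sub_apply, Pi.smul_apply, smul_eq_mul, Int.cast_zero, Int.cast_one, sp01, sp02, sp12, sq01, sq02, sq12, sf01, sf02, sf12] at t1
  have t2 := hS ![1, 0, 0] (by decide) ![0, 1, 0] (by decide) ![1, 1, 0] (by decide) (by decide) (by decide) ![0, -1, 0] ![0, 0, 1] ![0, 0, 1]
    (by norm_num [cast_vec3, vec3_dotProduct]) (by norm_num [cast_vec3, vec3_dotProduct]) (by norm_num [cast_vec3, vec3_dotProduct])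
  simp only [Matrix.mulVec, dotProduct, Fin.sum_univ_three, cons_val_zero, cons_val_one, cons_val_two, head_cons, tail_cons, Pi.add_apply, Pi.sub_apply, Pi.smul_apply, smul_eq_mul, Int.cast_zero, Int.cast_one, sp01, sp02, sp12, sq01, sq02, sq12, sf01, sf02, sf12] at t2
  have t3 := hS ![1, 0, 0] (by decide) ![0, 1, 0] (by decide) ![1, 1, 0] (by decide) (by decide) (by decide) ![0, -1, 0] ![0, 0, 1] ![1, -1, 0]
    (by norm_num [cast_vec3, vec3_dotProduct]) (by norm_num [cast_vec3, vec3_dotProduct]) (by norm_num [cast_vec3, vec3_dotProduct])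
  simp only [Matrix.mulVec, dotProduct, Fin.sum_univ_three, cons_val_zero, cons_val_one, cons_val_two, head_cons, tail_cons, Pi.add_apply, Pi.sub_apply, Pi.smul_apply, smul_eq_mul, Int.cast_zero, Int.cast_one, sp01, sp02, sp12, sq01, sq02, sq12, sf01, sf02, sf12] at t3
  have t4 := hS ![1, 0, 0] (by decide) ![0, 1, 0] (by decide) ![1, 1, 0] (by decide) (by decide) (by decide) ![0, -1, 0] ![1, 0, 0] ![0, 0, 1]
    (by norm_num [cast_vec3, vec3_dotProduct]) (by norm_num [cast_vec3, vec3_dotProduct]) (by norm_num [cast_vec3, vec3_dotProduct])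
  simp only [Matrix.mulVec, dotProduct, Fin.sum_univ_three, cons_val_zero, cons_val_one, cons_val_two, head_cons, tail_cons, Pi.add_apply, Pi.sub_apply, Pi.smul_apply, smul_eq_mul, Int.cast_zero, Int.cast_one, sp01, sp02, sp12, sq01, sq02, sq12, sf01, sf02, sf12] at t4
  have t5 := hS ![1, 0, 0] (by decide) ![0, 0, 1] (by decide) ![1, 0, 1] (by decide) (by decide) (by decide) ![0, -1, 0] ![1, 0, 0] ![0, -1, 0]
    (by norm_num [cast_vec3, vec3_dotProduct]) (by norm_num [cast_vec3, vec3_dotProduct]) (by norm_num [cast_vec3, vec3_dotProduct])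
  simp only [Matrix.mulVec, dotProduct, Fin.sum_univ_three, cons_val_zero, cons_val_one, cons_val_two, head_cons, tail_cons, Pi.add_apply, Pi.sub_apply, Pi.smul_apply, smul_eq_mul, Int.cast_zero, Int.cast_one, sp01, sp02, sp12, sr01, sr02, sr12, sg01, sg02, sg12] at t5
  have t6 := hS ![1, 0, 0] (by decide) ![0, 0, 1] (by decide) ![1, 0, 1] (by decide) (by decide) (by decide) ![0, 0, -1] ![0, -1, 0] ![0, -1, 0]
    (by norm_num [cast_vec3, vec3_dotProduct]) (by norm_num [cast_vec3, vec3_dotProduct]) (by norm_num [cast_vec3, vec3_dotProduct])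
  simp only [Matrix.mulVec, dotProduct, Fin.sum_univ_three, cons_val_zero, cons_val_one, cons_val_two, head_cons, tail_cons, Pi.add_apply, Pi.sub_apply, Pi.smul_apply, smul_eq_mul, Int.cast_zero, Int.cast_one, sp01, sp02, sp12, sr01, sr02, sr12, sg01, sg02, sg12] at t6
  have t7 := hS ![1, 0, 0] (by decide) ![0, 0, 1] (by decide) ![1, 0, 1] (by decide) (by decide) (by decide) ![0, 0, -1] ![0, -1, 0] ![1, 0, -1]
    (by norm_num [cast_vec3, vec3_dotProduct]) (by norm_num [cast_vec3, vec3_dotProduct]) (by norm_num [cast_vec3, vec3_dotProduct])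
  simp only [Matrix.mulVec, dotProduct, Fin.sum_univ_three, cons_val_zero, cons_val_one, cons_val_two, head_cons, tail_cons, Pi.add_apply, Pi.sub_apply, Pi.smul_apply, smul_eq_mul, Int.cast_zero, Int.cast_one, sp01, sp02, sp12, sr01, sr02, sr12, sg01, sg02, sg12] at t7
  have t8 := hS ![1, 0, 0] (by decide) ![0, 0, 1] (by decide) ![1, 0, 1] (by decide) (by decide) (by decide) ![0, 0, -1] ![1, 0, 0] ![0, -1, 0]
    (by norm_num [cast_vec3, vec3_dotProduct]) (by norm_num [cast_vec3, vec3_dotProduct]) (by norm_num [cast_vec3, vec3_dotProduct])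
  simp only [Matrix.mulVec, dotProduct, Fin.sum_univ_three, cons_val_zero, cons_val_one, cons_val_two, head_cons, tail_cons, Pi.add_apply, Pi.sub_apply, Pi.smul_apply, smul_eq_mul, Int.cast_zero, Int.cast_one, sp01, sp02, sp12, sr01, sr02, sr12, sg01, sg02, sg12] at t8
  have t9 := hS ![1, 0, 0] (by decide) ![0, 0, 1] (by decide) ![1, 0, 1] (by decide) (by decide) (by decide) ![0, 0, -1] ![1, 0, 0] ![1, 0, -1]
    (by norm_num [cast_vec3, vec3_dotProduct]) (by norm_num [cast_vec3, vec3_dotProduct]) (by norm_num [cast_vec3, vec3_dotProduct])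
  simp only [Matrix.mulVec, dotProduct, Fin.sum_univ_three, cons_val_zero, cons_val_one, cons_val_two, head_cons, tail_cons, Pi.add_apply, Pi.sub_apply, Pi.smul_apply, smul_eq_mul, Int.cast_zero, Int.cast_one, sp01, sp02, sp12, sr01, sr02, sr12, sg01, sg02, sg12] at t9
  have t10 := hS ![0, 1, 0] (by decide) ![0, 0, 1] (by decide) ![0, 1, 1] (by decide) (by decide) (by decide) ![1, 0, 0] ![0, 1, 0] ![1, 0, 0]
    (by norm_num [cast_vec3, vec3_dotProduct]) (by norm_num [cast_vec3, vec3_dotProduct]) (by norm_num [cast_vec3, vec3_dotProduct])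
  simp only [Matrix.mulVec, dotProduct, Fin.sum_univ_three, cons_val_zero, cons_val_one, cons_val_two, head_cons, tail_cons, Pi.add_apply, Pi.sub_apply, Pi.smul_apply, smul_eq_mul, Int.cast_zero, Int.cast_one, sq01, sq02, sq12, sr01, sr02, sr12, sh01, sh02, sh12] at t10
  have t11 := hS ![0, 1, 0] (by decide) ![0, 0, 1] (by decide) ![0, 1, 1] (by decide) (by decide) (by decide) ![0, 0, -1] ![1, 0, 0] ![1, 0, 0]
    (by norm_num [cast_vec3, vec3_dotProduct]) (by norm_num [cast_vec3, vec3_dotProduct]) (by norm_num [cast_vec3, vec3_dotProduct])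
  simp only [Matrix.mulVec, dotProduct, Fin.sum_univ_three, cons_val_zero, cons_val_one, cons_val_two, head_cons, tail_cons, Pi.add_apply, Pi.sub_apply, Pi.smul_apply, smul_eq_mul, Int.cast_zero, Int.cast_one, sq01, sq02, sq12, sr01, sr02, sr12, sh01, sh02, sh12] at t11
  have t12 := hS ![0, 1, 0] (by decide) ![0, 0, 1] (by decide) ![0, 1, 1] (by decide) (by decide) (by decide) ![0, 0, -1] ![1, 0, 0] ![0, 1, -1]
    (by norm_num [cast_vec3, vec3_dotProduct]) (by norm_num [cast_vec3, vec3_dotProduct]) (by norm_num [cast_vec3, vec3_dotProduct])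
  simp only [Matrix.mulVec, dotProduct, Fin.sum_univ_three, cons_val_zero, cons_val_one, cons_val_two, head_cons, tail_cons, Pi.add_apply, Pi.sub_apply, Pi.smul_apply, smul_eq_mul, Int.cast_zero, Int.cast_one, sq01, sq02, sq12, sr01, sr02, sr12, sh01, sh02, sh12] at t12
  have t13 := hS ![0, 1, 0] (by decide) ![0, 0, 1] (by decide) ![0, 1, 1] (by decide) (by decide) (by decide) ![0, 0, -1] ![0, 1, 0] ![1, 0, 0]
    (by norm_num [cast_vec3, vec3_dotProduct]) (by norm_num [cast_vec3, vec3_dotProduct]) (by norm_num [cast_vec3, vec3_dotProduct])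
  simp only [Matrix.mulVec, dotProduct, Fin.sum_univ_three, cons_val_zero, cons_val_one, cons_val_two, head_cons, tail_cons, Pi.add_apply, Pi.sub_apply, Pi.smul_apply, smul_eq_mul, Int.cast_zero, Int.cast_one, sq01, sq02, sq12, sr01, sr02, sr12, sh01, sh02, sh12] at t13
  have t14 := hS ![0, 1, 0] (by decide) ![0, 0, 1] (by decide) ![0, 1, 1] (by decide) (by decide) (by decide) ![0, 0, -1] ![0, 1, 0] ![0, 1, -1]
    (by norm_num [cast_vec3, vec3_dotProduct]) (by norm_num [cast_vec3, vec3_dotProduct]) (by norm_num [cast_vec3, vec3_dotProduct])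
  simp only [Matrix.mulVec, dotProduct, Fin.sum_univ_three, cons_val_zero, cons_val_one, cons_val_two, head_cons, tail_cons, Pi.add_apply, Pi.sub_apply, Pi.smul_apply, smul_eq_mul, Int.cast_zero, Int.cast_one, sq01, sq02, sq12, sr01, sr02, sr12, sh01, sh02, sh12] at t14
  have t15 := hS ![1, 0, 0] (by decide) ![0, 1, 1] (by decide) ![1, 1, 1] (by decide) (by decide) (by decide) ![0, -1, 1] ![2, 0, 0] ![0, -1, 1]
    (by norm_num [cast_vec3, vec3_dotProduct]) (by norm_num [cast_vec3, vec3_dotProduct]) (by norm_num [cast_vec3, vec3_dotProduct])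
  simp only [Matrix.mulVec, dotProduct, Fin.sum_univ_three, cons_val_zero, cons_val_one, cons_val_two, head_cons, tail_cons, Pi.add_apply, Pi.sub_apply, Pi.smul_apply, smul_eq_mul, Int.cast_zero, Int.cast_one, sp01, sp02, sp12, sh01, sh02, sh12, sd01, sd02, sd12] at t15
  have t16 := hS ![1, 0, 0] (by decide) ![0, 1, 1] (by decide) ![1, 1, 1] (by decide) (by decide) (by decide) ![0, -1, -1] ![0, -1, 1] ![0, -1, 1]
    (by norm_num [cast_vec3, vec3_dotProduct]) (by norm_num [cast_vec3, vec3_dotProduct]) (by norm_num [cast_vec3, vec3_dotProduct])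
  simp only [Matrix.mulVec, dotProduct, Fin.sum_univ_three, cons_val_zero, cons_val_one, cons_val_two, head_cons, tail_cons, Pi.add_apply, Pi.sub_apply, Pi.smul_apply, smul_eq_mul, Int.cast_zero, Int.cast_one, sp01, sp02, sp12, sh01, sh02, sh12, sd01, sd02, sd12] at t16
  have t17 := hS ![0, 1, 0] (by decide) ![1, 0, 1] (by decide) ![1, 1, 1] (by decide) (by decide) (by decide) ![1, 0, -1] ![0, 2, 0] ![1, 0, -1]
    (by norm_num [cast_vec3, vec3_dotProduct]) (by norm_num [cast_vec3, vec3_dotProduct]) (by norm_num [cast_vec3, vec3_dotProduct])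
  simp only [Matrix.mulVec, dotProduct, Fin.sum_univ_three, cons_val_zero, cons_val_one, cons_val_two, head_cons, tail_cons, Pi.add_apply, Pi.sub_apply, Pi.smul_apply, smul_eq_mul, Int.cast_zero, Int.cast_one, sq01, sq02, sq12, sg01, sg02, sg12, sd01, sd02, sd12] at t17
  have t18 := hS ![0, 1, 0] (by decide) ![1, 0, 1] (by decide) ![1, 1, 1] (by decide) (by decide) (by decide) ![-1, 0, -1] ![1, 0, -1] ![1, 0, -1]
    (by norm_num [cast_vec3, vec3_dotProduct]) (by norm_num [cast_vec3, vec3_dotProduct]) (by norm_num [cast_vec3, vec3_dotProduct])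
  simp only [Matrix.mulVec, dotProduct, Fin.sum_univ_three, cons_val_zero, cons_val_one, cons_val_two, head_cons, tail_cons, Pi.add_apply, Pi.sub_apply, Pi.smul_apply, smul_eq_mul, Int.cast_zero, Int.cast_one, sq01, sq02, sq12, sg01, sg02, sg12, sd01, sd02, sd12] at t18
  have t19 := hS ![0, 0, 1] (by decide) ![1, 1, 0] (by decide) ![1, 1, 1] (by decide) (by decide) (by decide) ![-1, 1, 0] ![0, 0, 2] ![-1, 1, 0]
    (by norm_num [cast_vec3, vec3_dotProduct]) (by norm_num [cast_vec3, vec3_dotProduct]) (by norm_num [cast_vec3, vec3_dotProduct])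
  simp only [Matrix.mulVec, dotProduct, Fin.sum_univ_three, cons_val_zero, cons_val_one, cons_val_two, head_cons, tail_cons, Pi.add_apply, Pi.sub_apply, Pi.smul_apply, smul_eq_mul, Int.cast_zero, Int.cast_one, sr01, sr02, sr12, sf01, sf02, sf12, sd01, sd02, sd12] at t19
  have t20 := hS ![0, 0, 1] (by decide) ![1, 1, 0] (by decide) ![1, 1, 1] (by decide) (by decide) (by decide) ![-1, -1, 0] ![-1, 1, 0] ![-1, 1, 0]
    (by norm_num [cast_vec3, vec3_dotProduct]) (by norm_num [cast_vec3, vec3_dotProduct]) (by norm_num [cast_vec3, vec3_dotProduct])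
  simp only [Matrix.mulVec, dotProduct, Fin.sum_univ_three, cons_val_zero, cons_val_one, cons_val_two, head_cons, tail_cons, Pi.add_apply, Pi.sub_apply, Pi.smul_apply, smul_eq_mul, Int.cast_zero, Int.cast_one, sr01, sr02, sr12, sf01, sf02, sf12, sd01, sd02, sd12] at t20
  have g1 : M ![1, 0, 0] 1 2 = 0 := by linear_combination (1 / 2 : ℝ) * t4 + (-1 / 2 : ℝ) * t8 + (-1 / 2 : ℝ) * t13 + (1 / 2 : ℝ) * cf2 + (1 / 2 : ℝ) * cg1 + (-1 / 2 : ℝ) * ch0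
  have g2 : M ![1, 0, 0] 2 2 = M ![1, 0, 0] 1 1 := by linear_combination (-1 : ℝ) * t1 + (-1 : ℝ) * t2 + (1 : ℝ) * t5 + (1 : ℝ) * t6 + (-1 : ℝ) * t14 + (2 : ℝ) * cq2 + (-2 : ℝ) * cr1 + (-1 : ℝ) * ch1 + (1 : ℝ) * ch2
  have g3 : M ![0, 1, 0] 2 2 = M ![1, 0, 0] 1 1 := by linear_combination (1 : ℝ) * t5 + (1 : ℝ) * t6 + (-1 : ℝ) * t14 + (2 : ℝ) * cq2 + (-2 : ℝ) * cr1 + (-1 : ℝ) * ch1 + (1 : ℝ) * ch2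
  have g4 : M ![0, 1, 0] 0 2 = 0 := by linear_combination (1 / 2 : ℝ) * t4 + (1 / 2 : ℝ) * t8 + (1 / 2 : ℝ) * t13 + (1 / 2 : ℝ) * cf2 + (-1 / 2 : ℝ) * cg1 + (1 / 2 : ℝ) * ch0
  have g5 : M ![0, 1, 0] 0 0 = M ![1, 0, 0] 1 1 := by linear_combination (-1 : ℝ) * t1 + (-1 : ℝ) * t2 + (1 : ℝ) * t5 + (1 : ℝ) * t6 + (1 : ℝ) * t9 + (-1 : ℝ) * t10 + (-1 : ℝ) * t11 + (-1 : ℝ) * t14 + (-2 : ℝ) * cp2 + (2 : ℝ) * cq2 + (2 : ℝ) * cr0 + (-2 : ℝ) * cr1 + (1 : ℝ) * cg0 + (-1 : ℝ) * cg2 + (-1 : ℝ) * ch1 + (1 : ℝ) * ch2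
  have g6 : M ![0, 0, 1] 0 0 = M ![1, 0, 0] 1 1 := by linear_combination (-1 : ℝ) * t1 + (-1 : ℝ) * t2 + (1 : ℝ) * t5 + (1 : ℝ) * t6 + (1 : ℝ) * t9 + (-1 : ℝ) * t14 + (-2 : ℝ) * cp2 + (2 : ℝ) * cq2 + (2 : ℝ) * cr0 + (-2 : ℝ) * cr1 + (1 : ℝ) * cg0 + (-1 : ℝ) * cg2 + (-1 : ℝ) * ch1 + (1 : ℝ) * ch2
  have g7 : M ![0, 0, 1] 0 1 = 0 := by linear_combination (-1 / 2 : ℝ) * t4 + (-1 / 2 : ℝ) * t8 + (1 / 2 : ℝ) * t13 + (-1 / 2 : ℝ) * cf2 + (1 / 2 : ℝ) * cg1 + (1 / 2 : ℝ) * ch0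
  have g8 : M ![0, 0, 1] 1 1 = M ![1, 0, 0] 1 1 := by linear_combination (1 : ℝ) * t5 + (1 : ℝ) * t6
  have g9 : M ![1, 1, 0] 2 2 = M ![1, 0, 0] 1 1 := by linear_combination (-1 : ℝ) * t2 + (1 : ℝ) * t5 + (1 : ℝ) * t6 + (-1 : ℝ) * t14 + (2 : ℝ) * cq2 + (-2 : ℝ) * cr1 + (-1 : ℝ) * ch1 + (1 : ℝ) * ch2
  have g10 : M ![1, 1, 0] 0 2 - M ![1, 1, 0] 1 2 = 0 := by linear_combination (-1 : ℝ) * t3 + (1 : ℝ) * t4 + (-2 : ℝ) * cq2 + (1 : ℝ) * cf2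
  have g11 : M ![1, 1, 0] 0 0 - 2 * M ![1, 1, 0] 0 1 + M ![1, 1, 0] 1 1 = 2 * M ![1, 0, 0] 1 1 := by linear_combination (-1 : ℝ) * t1 + (-1 : ℝ) * t2 + (1 : ℝ) * t4 + (2 : ℝ) * t5 + (2 : ℝ) * t6 + (1 : ℝ) * t8 + (1 : ℝ) * t9 + (-1 : ℝ) * t13 + (-1 : ℝ) * t14 + (1 / 2 : ℝ) * t19 + (1 / 2 : ℝ) * t20 + (-2 : ℝ) * cp2 + (2 : ℝ) * cq2 + (2 : ℝ) * cr0 + (-2 : ℝ) * cr1 + (1 : ℝ) * cf2 + (1 : ℝ) * cg0 + (-1 : ℝ) * cg1 + (-1 : ℝ) * cg2 + (-1 : ℝ) * ch0 + (-1 : ℝ) * ch1 + (1 : ℝ) * ch2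
  have g12 : M ![1, 0, 1] 1 1 = M ![1, 0, 0] 1 1 := by linear_combination (1 : ℝ) * t5
  have g13 : -M ![1, 0, 1] 0 1 + M ![1, 0, 1] 1 2 = 0 := by linear_combination (-1 : ℝ) * t7 + (1 : ℝ) * t8 + (2 : ℝ) * cr1 + (-1 : ℝ) * cg1
  have g14 : M ![1, 0, 1] 0 0 - 2 * M ![1, 0, 1] 0 2 + M ![1, 0, 1] 2 2 = 2 * M ![1, 0, 0] 1 1 := by linear_combination (-1 : ℝ) * t1 + (-1 : ℝ) * t2 + (-1 : ℝ) * t4 + (2 : ℝ) * t5 + (2 : ℝ) * t6 + (-1 : ℝ) * t8 + (1 : ℝ) * t9 + (-1 : ℝ) * t10 + (-1 : ℝ) * t11 + (-1 : ℝ) * t13 + (-2 : ℝ) * t14 + (1 / 2 : ℝ) * t17 + (1 / 2 : ℝ) * t18 + (-2 : ℝ) * cp2 + (4 : ℝ) * cq2 + (2 : ℝ) * cr0 + (-4 : ℝ) * cr1 + (-1 : ℝ) * cf2 + (1 : ℝ) * cg0 + (1 : ℝ) * cg1 + (-1 : ℝ) * cg2 + (-1 : ℝ) * ch0 + (-2 :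 ℝ) * ch1 + (2 : ℝ) * ch2
  have g15 : M ![0, 1, 1] 0 0 = M ![1, 0, 0] 1 1 := by linear_combination (-1 : ℝ) * t1 + (-1 : ℝ) * t2 + (1 : ℝ) * t5 + (1 : ℝ) * t6 + (1 : ℝ) * t9 + (-1 : ℝ) * t11 + (-1 : ℝ) * t14 + (-2 : ℝ) * cp2 + (2 : ℝ) * cq2 + (2 : ℝ) * cr0 + (-2 : ℝ) * cr1 + (1 : ℝ) * cg0 + (-1 : ℝ) * cg2 + (-1 : ℝ) * ch1 + (1 : ℝ) * ch2
  have g16 : M ![0, 1, 1] 0 1 - M ![0, 1, 1] 0 2 = 0 := by linear_combination (-1 : ℝ) * t12 + (1 : ℝ) * t13 + (-2 : ℝ) * cr0 + (1 : ℝ) * ch0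
  have g17 : M ![0, 1, 1] 1 1 - 2 * M ![0, 1, 1] 1 2 + M ![0, 1, 1] 2 2 = 2 * M ![1, 0, 0] 1 1 := by linear_combination (-1 : ℝ) * t1 + (-1 : ℝ) * t2 + (-1 : ℝ) * t4 + (1 : ℝ) * t5 + (1 : ℝ) * t6 + (1 : ℝ) * t8 + (1 : ℝ) * t13 + (-1 : ℝ) * t14 + (1 / 2 : ℝ) * t15 + (1 / 2 : ℝ) * t16 + (2 : ℝ) * cq2 + (-2 : ℝ) * cr1 + (-1 : ℝ) * cf2 + (-1 : ℝ) * cg1 + (1 : ℝ) * ch0 + (-1 : ℝ) * ch1 + (1 : ℝ) * ch2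
  have g18 : M ![1, 1, 1] 0 0 - 2 * M ![1, 1, 1] 0 1 + M ![1, 1, 1] 1 1 = 2 * M ![1, 0, 0] 1 1 := by linear_combination (-1 : ℝ) * t1 + (-1 : ℝ) * t2 + (1 : ℝ) * t4 + (2 : ℝ) * t5 + (2 : ℝ) * t6 + (1 : ℝ) * t8 + (1 : ℝ) * t9 + (-1 : ℝ) * t13 + (-1 : ℝ) * t14 + (1 / 2 : ℝ) * t19 + (-2 : ℝ) * cp2 + (2 : ℝ) * cq2 + (2 : ℝ) * cr0 + (-2 : ℝ) * cr1 + (1 : ℝ) * cf2 + (1 : ℝ) * cg0 + (-1 : ℝ) * cg1 + (-1 : ℝ) * cg2 + (-1 : ℝ) * ch0 + (-1 : ℝ) * ch1 + (1 : ℝ) * ch2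
  have g19 : M ![1, 1, 1] 0 0 - M ![1, 1, 1] 1 1 - 2 * M ![1, 1, 1] 0 2 + 2 * M ![1, 1, 1] 1 2 = 0 := by linear_combination (1 : ℝ) * t5 + (1 : ℝ) * t6 + (-2 : ℝ) * t8 + (1 : ℝ) * t9 + (-1 : ℝ) * t10 + (-1 : ℝ) * t11 + (-2 : ℝ) * t13 + (-1 : ℝ) * t14 + (-1 / 2 : ℝ) * t15 + (1 / 2 : ℝ) * t17 + (-2 : ℝ) * cp2 + (2 : ℝ) * cq2 + (2 : ℝ) * cr0 + (-2 : ℝ) * cr1 + (1 : ℝ) * cg0 + (2 : ℝ) * cg1 + (-1 : ℝ) * cg2 + (-2 : ℝ) * ch0 + (-1 : ℝ) * ch1 + (1 : ℝ) * ch2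
  have g20 : M ![1, 1, 1] 0 0 + M ![1, 1, 1] 1 1 + 4 * M ![1, 1, 1] 2 2 + 2 * M ![1, 1, 1] 0 1 - 4 * M ![1, 1, 1] 0 2 - 4 * M ![1, 1, 1] 1 2 = 6 * M ![1, 0, 0] 1 1 := by linear_combination (-3 : ℝ) * t1 + (-3 : ℝ) * t2 + (-5 : ℝ) * t4 + (4 : ℝ) * t5 + (4 : ℝ) * t6 + (-1 : ℝ) * t8 + (1 : ℝ) * t9 + (-2 : ℝ) * t10 + (-2 : ℝ) * t11 + (1 : ℝ) * t13 + (-5 : ℝ) * t14 + (1 : ℝ) * t15 + (1 : ℝ) * t17 + (-1 / 2 : ℝ) * t19 + (-2 : ℝ) * cp2 + (10 : ℝ) * cq2 + (2 : ℝ) * cr0 + (-10 : ℝ) * cr1 + (-5 : ℝ) * cf2 + (1 : ℝ) * cg0 + (1 : ℝ) * cg1 + (-1 : ℝ) * cg2 + (1 : ℝ) * ch0 + (-5 : ℝ) * ch1 + (5 : ℝ) * ch2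
  clear t1 t2 t3 t4 t5 t6 t7 t8 t9 t10 t11 t12 t13 t14 t15 t16 t17 t18 t19 t20 cp2 cq2 cr0 cr1 cf2 cg0 cg1 cg2 ch0 ch1 ch2
  refine ⟨M ![1, 0, 0] 1 1, fun k hk => ?_⟩
  simp only [Finset.mem_insert, Finset.mem_singleton] at hk
  rcases hk with rfl | rfl | rfl | rfl | rfl | rfl | rfl
  · refine mulVec_eq_smul_of_basis (M ![1, 0, 0]) _ ![0, 1, 0] (M ![1, 0, 0] 1 1) sp kp
      (by norm_num [cast_vec3, vec3_dotProduct]) ?_ ?_ ?_ ?_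
    · rw [cast_vec3]; intro h; have := congrFun h 2
      simp only [cross_apply, cons_val_zero, cons_val_one, cons_val_two, head_cons, tail_cons, Pi.zero_apply, Int.cast_zero, Int.cast_one] at this; norm_num at this
    · simp only [Matrix.mulVec, dotProduct, Fin.sum_univ_three, cons_val_zero, cons_val_one, cons_val_two, head_cons, tail_cons, sp01, sp02, sp12]; linear_combination 
    · simp only [cast_vec3, Matrix.mulVec, dotProduct, Fin.sum_univ_three, cons_val_zero, cons_val_one, cons_val_two, head_cons, tail_cons, Int.cast_zero, Int.cast_one, cross_apply, sp01, sp02, sp12]; linear_combination g1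
    · simp only [cast_vec3, Matrix.mulVec, dotProduct, Fin.sum_univ_three, cons_val_zero, cons_val_one, cons_val_two, head_cons, tail_cons, Int.cast_zero, Int.cast_one, cross_apply, sp01, sp02, sp12]; linear_combination g2
  · refine mulVec_eq_smul_of_basis (M ![0, 1, 0]) _ ![0, 0, 1] (M ![1, 0, 0] 1 1) sq kq
      (by norm_num [cast_vec3, vec3_dotProduct]) ?_ ?_ ?_ ?_
    · rw [cast_vec3]; intro h; have := congrFun h 0
      simp only [cross_apply, cons_val_zero, cons_val_one, cons_val_two, head_cons, tail_cons, Pi.zero_apply, Int.cast_zero, Int.cast_one] at this; norm_num at this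
    · simp only [Matrix.mulVec, dotProduct, Fin.sum_univ_three, cons_val_zero, cons_val_one, cons_val_two, head_cons, tail_cons, sq01, sq02, sq12]; linear_combination g3
    · simp only [cast_vec3, Matrix.mulVec, dotProduct, Fin.sum_univ_three, cons_val_zero, cons_val_one, cons_val_two, head_cons, tail_cons, Int.cast_zero, Int.cast_one, cross_apply, sq01, sq02, sq12]; linear_combination g4
    · simp only [cast_vec3, Matrix.mulVec, dotProduct, Fin.sum_univ_three, cons_val_zero, cons_val_one, cons_val_two, head_cons, tail_cons, Int.cast_zero, Int.cast_one, cross_apply, sq01, sq02, sq12]; linear_combination g5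
  · refine mulVec_eq_smul_of_basis (M ![0, 0, 1]) _ ![1, 0, 0] (M ![1, 0, 0] 1 1) sr kr
      (by norm_num [cast_vec3, vec3_dotProduct]) ?_ ?_ ?_ ?_
    · rw [cast_vec3]; intro h; have := congrFun h 1
      simp only [cross_apply, cons_val_zero, cons_val_one, cons_val_two, head_cons, tail_cons, Pi.zero_apply, Int.cast_zero, Int.cast_one] at this; norm_num at this
    · simp only [Matrix.mulVec, dotProduct, Fin.sum_univ_three, cons_val_zero, cons_val_one, cons_val_two, head_cons, tail_cons, sr01, sr02, sr12]; linear_combination g6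
    · simp only [cast_vec3, Matrix.mulVec, dotProduct, Fin.sum_univ_three, cons_val_zero, cons_val_one, cons_val_two, head_cons, tail_cons, Int.cast_zero, Int.cast_one, cross_apply, sr01, sr02, sr12]; linear_combination g7
    · simp only [cast_vec3, Matrix.mulVec, dotProduct, Fin.sum_univ_three, cons_val_zero, cons_val_one, cons_val_two, head_cons, tail_cons, Int.cast_zero, Int.cast_one, cross_apply, sr01, sr02, sr12]; linear_combination g8
  · refine mulVec_eq_smul_of_basis (M ![1, 1, 0]) _ ![0, 0, 1] (M ![1, 0, 0] 1 1) sf kf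
      (by norm_num [cast_vec3, vec3_dotProduct]) ?_ ?_ ?_ ?_
    · rw [cast_vec3]; intro h; have := congrFun h 0
      simp only [cross_apply, cons_val_zero, cons_val_one, cons_val_two, head_cons, tail_cons, Pi.zero_apply, Int.cast_zero, Int.cast_one] at this; norm_num at this
    · simp only [Matrix.mulVec, dotProduct, Fin.sum_univ_three, cons_val_zero, cons_val_one, cons_val_two, head_cons, tail_cons, sf01, sf02, sf12]; linear_combination g9
    · simp only [cast_vec3, Matrix.mulVec, dotProduct, Fin.sum_univ_three, cons_val_zero, cons_val_one, cons_val_two, head_cons, tail_cons, Int.cast_zero, Int.cast_one, cross_apply, sf01, sf02, sf12]; linear_combination g10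
    · simp only [cast_vec3, Matrix.mulVec, dotProduct, Fin.sum_univ_three, cons_val_zero, cons_val_one, cons_val_two, head_cons, tail_cons, Int.cast_zero, Int.cast_one, cross_apply, sf01, sf02, sf12]; linear_combination g11
  · refine mulVec_eq_smul_of_basis (M ![1, 0, 1]) _ ![0, 1, 0] (M ![1, 0, 0] 1 1) sg kg
      (by norm_num [cast_vec3, vec3_dotProduct]) ?_ ?_ ?_ ?_
    · rw [cast_vec3]; intro h; have := congrFun h 0
      simp only [cross_apply, cons_val_zero, cons_val_one, cons_val_two, head_cons, tail_cons, Pi.zero_apply, Int.cast_zero, Int.cast_one] at this; norm_num at this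
    · simp only [Matrix.mulVec, dotProduct, Fin.sum_univ_three, cons_val_zero, cons_val_one, cons_val_two, head_cons, tail_cons, sg01, sg02, sg12]; linear_combination g12
    · simp only [cast_vec3, Matrix.mulVec, dotProduct, Fin.sum_univ_three, cons_val_zero, cons_val_one, cons_val_two, head_cons, tail_cons, Int.cast_zero, Int.cast_one, cross_apply, sg01, sg02, sg12]; linear_combination g13
    · simp only [cast_vec3, Matrix.mulVec, dotProduct, Fin.sum_univ_three, cons_val_zero, cons_val_one, cons_val_two, head_cons, tail_cons, Int.cast_zero, Int.cast_one, cross_apply, sg01, sg02, sg12]; linear_combination g14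
  · refine mulVec_eq_smul_of_basis (M ![0, 1, 1]) _ ![1, 0, 0] (M ![1, 0, 0] 1 1) sh kh
      (by norm_num [cast_vec3, vec3_dotProduct]) ?_ ?_ ?_ ?_
    · rw [cast_vec3]; intro h; have := congrFun h 1
      simp only [cross_apply, cons_val_zero, cons_val_one, cons_val_two, head_cons, tail_cons, Pi.zero_apply, Int.cast_zero, Int.cast_one] at this; norm_num at this
    · simp only [Matrix.mulVec, dotProduct, Fin.sum_univ_three, cons_val_zero, cons_val_one, cons_val_two, head_cons, tail_cons, sh01, sh02, sh12]; linear_combination g15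
    · simp only [cast_vec3, Matrix.mulVec, dotProduct, Fin.sum_univ_three, cons_val_zero, cons_val_one, cons_val_two, head_cons, tail_cons, Int.cast_zero, Int.cast_one, cross_apply, sh01, sh02, sh12]; linear_combination g16
    · simp only [cast_vec3, Matrix.mulVec, dotProduct, Fin.sum_univ_three, cons_val_zero, cons_val_one, cons_val_two, head_cons, tail_cons, Int.cast_zero, Int.cast_one, cross_apply, sh01, sh02, sh12]; linear_combination g17
  · refine mulVec_eq_smul_of_basis (M ![1, 1, 1]) _ ![1, -1, 0] (M ![1, 0, 0] 1 1) sd kd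
      (by norm_num [cast_vec3, vec3_dotProduct]) ?_ ?_ ?_ ?_
    · rw [cast_vec3]; intro h; have := congrFun h 0
      simp only [cross_apply, cons_val_zero, cons_val_one, cons_val_two, head_cons, tail_cons, Pi.zero_apply, Int.cast_one] at this; norm_num at this
    · simp only [Matrix.mulVec, dotProduct, Fin.sum_univ_three, cons_val_zero, cons_val_one, cons_val_two, head_cons, tail_cons, sd01, sd02, sd12]; linear_combination g18
    · simp only [cast_vec3, Matrix.mulVec, dotProduct, Fin.sum_univ_three, cons_val_zero, cons_val_one, cons_val_two, head_cons, tail_cons, Int.cast_one, cross_apply, sd01, sd02, sd12]; linear_combination g19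
    · simp only [cast_vec3, Matrix.mulVec, dotProduct, Fin.sum_univ_three, cons_val_zero, cons_val_one, cons_val_two, head_cons, tail_cons, Int.cast_one, cross_apply, sd01, sd02, sd12]; linear_combination g20

/-- **Rigidity of the antisymmetric blocks on the unit box.**  Scalars on the unit box `U`
satisfying the antisymmetric triad identity on its six internal triads are all equal. [folklore] -/
theorem unitBox_A :
    ∀ (lam : (Fin 3 → ℤ) → ℝ),
    (∀ a ∈ ({![1, 0, 0], ![0, 1, 0], ![0, 0, 1], ![1, 1, 0], ![1, 0, 1], ![0, 1, 1], ![1, 1, 1]} : Finset (Fin 3 → ℤ)), ∀ b ∈ ({![1, 0, 0], ![0, 1, 0], ![0, 0, 1], ![1, 1, 0], ![1, 0, 1], ![0, 1, 1], ![1, 1, 1]} : Finset (Fin 3 → ℤ)), ∀ c ∈ ({![1, 0, 0], ![0, 1, 0], ![0, 0, 1], ![1, 1, 0], ![1, 0, 1], ![0, 1, 1], ![1, 1, 1]} : Finset (Fin 3 → ℤ)), a + b = c → crossProduct a b ≠ 0 →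
      ∀ ua ub uc : Fin 3 → ℝ, ua ⬝ᵥ (fun i => (a i : ℝ)) = 0 → ub ⬝ᵥ (fun i => (b i : ℝ)) = 0 →
        uc ⬝ᵥ (fun i => (c i : ℝ)) = 0 →
        lam a * (((uc ⬝ᵥ fun i => (b i : ℝ)) • ub - (ub ⬝ᵥ fun i => (a i : ℝ)) • uc) ⬝ᵥ
            crossProduct (fun i => (a i : ℝ)) ua) +
        lam b * (((uc ⬝ᵥ fun i => (a i : ℝ)) • ua - (ua ⬝ᵥ fun i => (b i : ℝ)) • uc) ⬝ᵥ
            crossProduct (fun i => (b i : ℝ)) ub) -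
        lam c * (((ua ⬝ᵥ fun i => (b i : ℝ)) • ub + (ub ⬝ᵥ fun i => (a i : ℝ)) • ua) ⬝ᵥ
            crossProduct (fun i => (c i : ℝ)) uc) = 0) →
    ∃ β : ℝ, ∀ k ∈ ({![1, 0, 0], ![0, 1, 0], ![0, 0, 1], ![1, 1, 0], ![1, 0, 1], ![0, 1, 1], ![1, 1, 1]} : Finset (Fin 3 → ℤ)), lam k = β := by
  intro lam hA
  have t1 := hA ![1, 0, 0] (by decide) ![0, 0, 1] (by decide) ![1, 0, 1] (by decide) (by decide) (by decide) ![0, 0, -1] ![0, -1, 0] ![1, 0, -1]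
    (by norm_num [cast_vec3, vec3_dotProduct]) (by norm_num [cast_vec3, vec3_dotProduct]) (by norm_num [cast_vec3, vec3_dotProduct])
  simp only [cast_vec3, vec3_dotProduct, cross_apply, cons_val_zero, cons_val_one, cons_val_two, head_cons, tail_cons, Pi.add_apply, Pi.sub_apply, Pi.smul_apply, smul_eq_mul, Int.cast_zero, Int.cast_one] at t1
  have t2 := hA ![1, 0, 0] (by decide) ![0, 0, 1] (by decide) ![1, 0, 1] (by decide) (by decide) (by decide) ![0, 0, -1] ![1, 0, 0] ![0, -1, 0]
    (by norm_num [cast_vec3, vec3_dotProduct]) (by norm_num [cast_vec3, vec3_dotProduct]) (by norm_num [cast_vec3, vec3_dotProduct])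
  simp only [cast_vec3, vec3_dotProduct, cross_apply, cons_val_zero, cons_val_one, cons_val_two, head_cons, tail_cons, Pi.add_apply, Pi.sub_apply, Pi.smul_apply, smul_eq_mul, Int.cast_zero, Int.cast_one] at t2
  have t3 := hA ![0, 1, 0] (by decide) ![0, 0, 1] (by decide) ![0, 1, 1] (by decide) (by decide) (by decide) ![0, 0, -1] ![1, 0, 0] ![0, 1, -1]
    (by norm_num [cast_vec3, vec3_dotProduct]) (by norm_num [cast_vec3, vec3_dotProduct]) (by norm_num [cast_vec3, vec3_dotProduct])
  simp only [cast_vec3, vec3_dotProduct, cross_apply, cons_val_zero, cons_val_one, cons_val_two, head_cons, tail_cons, Pi.add_apply, Pi.sub_apply, Pi.smul_apply, smul_eq_mul, Int.cast_zero, Int.cast_one] at t3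
  have t4 := hA ![0, 1, 0] (by decide) ![0, 0, 1] (by decide) ![0, 1, 1] (by decide) (by decide) (by decide) ![0, 0, -1] ![0, 1, 0] ![1, 0, 0]
    (by norm_num [cast_vec3, vec3_dotProduct]) (by norm_num [cast_vec3, vec3_dotProduct]) (by norm_num [cast_vec3, vec3_dotProduct])
  simp only [cast_vec3, vec3_dotProduct, cross_apply, cons_val_zero, cons_val_one, cons_val_two, head_cons, tail_cons, Pi.add_apply, Pi.sub_apply, Pi.smul_apply, smul_eq_mul, Int.cast_zero, Int.cast_one] at t4
  have t5 := hA ![0, 1, 0] (by decide) ![1, 0, 1] (by decide) ![1, 1, 1] (by decide) (by decide) (by decide) ![-1, 0, -1] ![0, 2, 0] ![1, 0, -1]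
    (by norm_num [cast_vec3, vec3_dotProduct]) (by norm_num [cast_vec3, vec3_dotProduct]) (by norm_num [cast_vec3, vec3_dotProduct])
  simp only [cast_vec3, vec3_dotProduct, cross_apply, cons_val_zero, cons_val_one, cons_val_two, head_cons, tail_cons, Pi.add_apply, Pi.sub_apply, Pi.smul_apply, smul_eq_mul, Int.cast_zero, Int.cast_one] at t5
  have t6 := hA ![0, 0, 1] (by decide) ![1, 1, 0] (by decide) ![1, 1, 1] (by decide) (by decide) (by decide) ![-1, -1, 0] ![-1, 1, 0] ![-1, -1, 2]
    (by norm_num [cast_vec3, vec3_dotProduct]) (by norm_num [cast_vec3, vec3_dotProduct]) (by norm_num [cast_vec3, vec3_dotProduct])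
  simp only [cast_vec3, vec3_dotProduct, cross_apply, cons_val_zero, cons_val_one, cons_val_two, head_cons, tail_cons, Pi.add_apply, Pi.sub_apply, Pi.smul_apply, smul_eq_mul, Int.cast_zero, Int.cast_one] at t6
  have g1 : lam ![0, 1, 0] = lam ![1, 0, 0] := by linear_combination (-1 : ℝ) * t2 + (1 : ℝ) * t4
  have g2 : lam ![0, 0, 1] = lam ![1, 0, 0] := by linear_combination (-1 : ℝ) * t2
  have g3 : lam ![1, 1, 0] = lam ![1, 0, 0] := by linear_combination (-3 / 2 : ℝ) * t1 + (1 / 2 : ℝ) * t2 + (-3 / 2 : ℝ) * t4 + (3 / 8 : ℝ) * t5 + (1 / 8 : ℝ) * t6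
  have g4 : lam ![1, 0, 1] = lam ![1, 0, 0] := by linear_combination (-1 / 2 : ℝ) * t1 + (-1 / 2 : ℝ) * t2
  have g5 : lam ![0, 1, 1] = lam ![1, 0, 0] := by linear_combination (-1 : ℝ) * t2 + (-1 / 2 : ℝ) * t3 + (1 / 2 : ℝ) * t4
  have g6 : lam ![1, 1, 1] = lam ![1, 0, 0] := by linear_combination (-1 : ℝ) * t1 + (-1 : ℝ) * t4 + (1 / 4 : ℝ) * t5
  refine ⟨lam ![1, 0, 0], fun k hk => ?_⟩
  simp only [Finset.mem_insert, Finset.mem_singleton] at hk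
  rcases hk with rfl | rfl | rfl | rfl | rfl | rfl | rfl
  · rfl
  · exact g1
  · exact g2
  · exact g3
  · exact g4
  · exact g5
  · exact g6

end Summit.AnomalousDissipation.AnomalousDissipation.Theorems.MomentParityCubicParityLoud
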